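import Literature.NumberTheory.Sieve.GoldstonPintzYildirimJointCounting
import HarnessLib

/-!
# Goldston–Pintz–Yıldırım, *Primes in tuples I*, §9 (9.7)–(9.11): the sum twisted by `θ(n + h₀)`

Trunk: NumberTheory / Sieve. The arithmetic opening of the proof of GPY **Proposition 2**
(D. A. Goldston, J. Pintz, C. Y. Yıldırım, *Primes in tuples. I*, Ann. of Math. 170 (2009) =
arXiv:math/0508185, §9, pp. 18–19), continuing `GoldstonPintzYildirimJointCounting` (§7,
(7.3)–(7.6)) for the sum
`S̃_R(N; H₁, H₂, ℓ₁, ℓ₂, h₀) = ∑_{n ≤ N} Λ_R(n; H₁, ℓ₁) Λ_R(n; H₂, ℓ₂) θ(n + h₀)`.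
Everything here is PROVED.

* `Literature.NumberTheory.Sieve.GPY.thetaMod N q a = θ(N; q, a) = ∑_{1 ≤ m ≤ N, m ≡ a (q)} θ(m)` ((9.1)) and
  `Literature.NumberTheory.Sieve.GPY.thetaErr N q = E'(N, q) = max_{(a,q)=1} |θ(N; q, a) − N/φ(q)|` ((9.2));
* `Literature.NumberTheory.Sieve.GPY.nuStarPrime h₀ G p = ν*_p(G⁰) = ν_p(G ∪ {h₀}) − 1` ((9.9)–(9.10)),
  `Literature.NumberTheory.Sieve.GPY.nuBarStar h₀ H₁ H₂ p = ν̄*_p((H₁ ∩̄ H₂)⁰)` ("defined as in (7.5)"),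
  `Literature.NumberTheory.Sieve.GPY.nuJointStar h₀ H₁ H₂ d e = ν*_{a₁}(H₁⁰) ν*_{a₂}(H₂⁰) ν̄*_{a₁₂}((H₁ ∩̄ H₂)⁰)`
  as the product of local factors over `p ∣ [d, e]` (`nuJointStar_eq` identifies it with the
  printed three-factor form, `d = a₁a₁₂`, `e = a₂a₁₂`, `a₁₂ = (d, e)`, via the multiplicative
  extension `Literature.NumberTheory.Sieve.GPY.nuStar h₀ G d = ν*_d(G⁰)`);
* `card_filter_range_lcm_coprime` — the count behind (9.9)–(9.11): for squarefree `d, e`, among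
  the `nuJoint` residue classes `b (mod [d,e])` with `d ∣ P_{H₁}(b)`, `e ∣ P_{H₂}(b)` exactly
  `nuJointStar` have `(b + h₀, [d, e]) = 1` (CRT);
* `sum_lambdaR_mul_theta_eq` — **(9.7)**;
* `abs_sum_theta_filter_sub_le` — **(9.8)–(9.11)** with explicit constants: for squarefree `d, e`,
  `|∑_{n ≤ N, d ∣ P_{H₁}(n), e ∣ P_{H₂}(n)} θ(n + h₀) − nuJointStar · N/φ([d,e])|`
  `≤ nuJoint · (E'(N, [d,e]) + log [d,e] + h₀ log(N + h₀))`
  (coprime classes: `θ(N; q, b + h₀) = N/φ(q) + E`; non-coprime classes: `θ(N; q, c) ≤ log q`,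
  only primes dividing `q` occur; the shift `n ↦ n + h₀` costs `≤ h₀ log(N + h₀)` per class);
* `Literature.NumberTheory.Sieve.GPY.mainTRTheta R H₁ H₂ ℓ₁ ℓ₂ h₀ = 𝒯̃_R(H₁, H₂, ℓ₁, ℓ₂, h₀)`, the main term of
  (9.12), and `abs_sumTheta_sub_mainTRTheta_le` — the first line of **(9.12)**:
  `|S̃_R − N 𝒯̃_R| ≤ ((log R)^{K₁+K₂}/(K₁!K₂!)) ∑_{d,e ≤ R}♭ nuJoint(d,e) (E'(N,[d,e]) + 2 log R + h₀ log(N+h₀))`.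

The Bombieri–Vinogradov step (9.13)–(9.14) is the subject of the sibling file
`GoldstonPintzYildirimThetaBV`.

Design notes. The squarefreeness of `[d, e]` for squarefree `d, e` is used inline (proof of
`card_filter_range_lcm_coprime`), as in the imported `card_filter_range_lcm`; top-level twins exist
elsewhere in the topic (`Literature.NumberTheory.Sieve.MaynardSieve.squarefree_lcm` in
`MaynardSieveCounting2.lean`, `squarefree_lcm` in `AsymptoticSieveForPrimesS1.lean`) and are not
imported to keep this file on the GPY import chain; a librarian may consolidate.

## References

* D. A. Goldston, J. Pintz, C. Y. Yıldırım, *Primes in tuples. I*, Ann. of Math. (2) 170 (2009),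
  819–862 = arXiv:math/0508185, §9, (9.1)–(9.2), (9.7)–(9.12), pp. 18–19.
  [cite: GoldstonPintzYildirim2009]
-/

noncomputable section

open Finset
open scoped ArithmeticFunction.Moebius ArithmeticFunction.omega

namespace Literature.NumberTheory.Sieve.GPY

/-! ### `θ(N; q, a)` and `E'(N, q)` ((9.1)–(9.2)) -/

/-- GPY (9.1): `θ(N; q, a) = ∑_{1 ≤ m ≤ N, m ≡ a (mod q)} θ(m)` (`θ` = `Literature.NumberTheory.Sieve.GPY.theta`,
`log` at primes), for a residue class `a : ZMod q`.
[cite: GoldstonPintzYildirim2009, Section 9 eq. 9.1] -/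
def thetaMod (N q : ℕ) (a : ZMod q) : ℝ :=
  ∑ m ∈ (Icc 1 N).filter (fun m : ℕ => (m : ZMod q) = a), theta m

/-- GPY (9.2): `E'(N, q) = max_{(a, q) = 1} |E(N; q, a)|`, `E(N; q, a) = θ(N; q, a) − N/φ(q)` for
`(a, q) = 1`, as a supremum over the units of `ZMod q` (a maximum for `q ≥ 1`).
[cite: GoldstonPintzYildirim2009, Section 9 eq. 9.2] -/
def thetaErr (N q : ℕ) : ℝ :=
  ⨆ a : (ZMod q)ˣ, |thetaMod N q (a : ZMod q) - (N : ℝ) / (Nat.totient q : ℝ)|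

/-- `θ(N; q, a) ≥ 0`. [folklore] -/
theorem thetaMod_nonneg (N q : ℕ) (a : ZMod q) : 0 ≤ thetaMod N q a :=
  Finset.sum_nonneg fun m _ => theta_nonneg m

/-- `E'(N, q) ≥ 0`. [folklore] -/
theorem thetaErr_nonneg (N q : ℕ) : 0 ≤ thetaErr N q :=
  Real.iSup_nonneg fun _ => abs_nonneg _

/-- `|θ(N; q, a) − N/φ(q)| ≤ E'(N, q)` for every reduced class `a` (the unit group of `ZMod q` is
finite for every `q`, including the junk modulus `q = 0`). [folklore] -/
theorem abs_thetaMod_sub_le_thetaErr (N q : ℕ) (a : (ZMod q)ˣ) :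
    |thetaMod N q (a : ZMod q) - (N : ℝ) / (Nat.totient q : ℝ)| ≤ thetaErr N q :=
  le_ciSup (f := fun a : (ZMod q)ˣ =>
    |thetaMod N q (a : ZMod q) - (N : ℝ) / (Nat.totient q : ℝ)|) (Set.finite_range _).bddAbove a

/-- `E'(N, q) ≤ B` as soon as `|θ(N; q, a) − N/φ(q)| ≤ B` for all reduced classes and `B ≥ 0`.
[folklore] -/
theorem thetaErr_le {N q : ℕ} {B : ℝ} (hB : 0 ≤ B)
    (h : ∀ a : (ZMod q)ˣ, |thetaMod N q (a : ZMod q) - (N : ℝ) / (Nat.totient q : ℝ)| ≤ B) :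
    thetaErr N q ≤ B :=
  Real.iSup_le h hB

/-! ### `ν*` and the local counts with the coprimality condition ((9.9)–(9.10)) -/

/-- GPY (9.9)–(9.10): `ν*_p(G⁰) := ν_p(G⁰) − 1`, `G⁰ = G ∪ {h₀}` — the number of classes
`b (mod p)` with `p ∣ P_G(b)` and `p ∤ b + h₀` (`card_filter_range_prime_dvd_not_dvd`). (The source
writes `ν*_p(G) = ν_p(G⁰) − 1` and then `ν*_{a}(H₁⁰)`; since `(G⁰)⁰ = G⁰` both readings agree.)
[cite: GoldstonPintzYildirim2009, Section 9 eq. 9.9] -/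
def nuStarPrime (h₀ : ℕ) (G : Finset ℕ) (p : ℕ) : ℕ := nuPrime (insert h₀ G) p - 1

/-- `ν̄*_p((H₁ ∩̄ H₂)⁰) := ν̄_p(H₁⁰ ∩̄ H₂⁰) − 1` — the number of classes `b (mod p)` with
`p ∣ P_{H₁}(b)`, `p ∣ P_{H₂}(b)` and `p ∤ b + h₀` (`card_filter_range_prime_dvd_and_not_dvd`); equal
to the source's "defined as in (7.5)" expression `ν*_p(H₁⁰) + ν*_p(H₂⁰) − ν*_p(H⁰)`
(`nuBarStar_eq`). [cite: GoldstonPintzYildirim2009, Section 9 eq. 9.10] -/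
def nuBarStar (h₀ : ℕ) (H₁ H₂ : Finset ℕ) (p : ℕ) : ℕ := nuBar (insert h₀ H₁) (insert h₀ H₂) p - 1

/-- The local factor at `p ∣ [d, e]` of the number of classes modulo `[d, e]` with
`d ∣ P_{H₁}(b)`, `e ∣ P_{H₂}(b)`, `(b + h₀, [d,e]) = 1`: `ν*_p(H₁⁰)` if `p ∣ a₁`, `ν*_p(H₂⁰)` if
`p ∣ a₂`, `ν̄*_p((H₁ ∩̄ H₂)⁰)` if `p ∣ a₁₂` (GPY §9 after (9.10)).
[cite: GoldstonPintzYildirim2009, Section 9 eq. 9.11] -/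
def nuJointStarPrime (h₀ : ℕ) (H₁ H₂ : Finset ℕ) (d e p : ℕ) : ℕ :=
  if p ∣ d then (if p ∣ e then nuBarStar h₀ H₁ H₂ p else nuStarPrime h₀ H₁ p)
  else nuStarPrime h₀ H₂ p

/-- `ν*_{a₁}(H₁⁰) ν*_{a₂}(H₂⁰) ν̄*_{a₁₂}((H₁ ∩̄ H₂)⁰)` for `d = a₁a₁₂`, `e = a₂a₁₂`: the number of
classes `b (mod [d, e])` with `d ∣ P_{H₁}(b)`, `e ∣ P_{H₂}(b)` and `(b + h₀, [d, e]) = 1`, as the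
product of its local factors (GPY (9.11); `card_filter_range_lcm_coprime`, `nuJointStar_eq`).
[cite: GoldstonPintzYildirim2009, Section 9 eq. 9.11] -/
def nuJointStar (h₀ : ℕ) (H₁ H₂ : Finset ℕ) (d e : ℕ) : ℕ :=
  ∏ p ∈ (Nat.lcm d e).primeFactors, nuJointStarPrime h₀ H₁ H₂ d e p

/-- `P_{{h₀}}(x) = x + h₀`. [folklore] -/
theorem tuplePoly_singleton (h₀ x : ℕ) : tuplePoly {h₀} x = x + h₀ := by
  simp [tuplePoly]

/-- Exactly one class `x (mod p)` has `p ∣ x + h₀` (`p` prime). [folklore] -/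
theorem card_filter_range_prime_dvd_add {p : ℕ} (hp : p.Prime) (h₀ : ℕ) :
    #((range p).filter fun x => p ∣ x + h₀) = 1 := by
  have h := card_filter_range_prime_dvd hp {h₀}
  simp only [tuplePoly_singleton] at h
  rw [h, nuPrime, Finset.image_singleton, Finset.card_singleton]

/-- `p ∣ P_{G ∪ {h₀}}(x) ↔ p ∣ x + h₀ ∨ p ∣ P_G(x)` (`p` prime). [folklore] -/
theorem prime_dvd_tuplePoly_insert_iff {p : ℕ} (hp : p.Prime) (h₀ : ℕ) (G : Finset ℕ) (x : ℕ) :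
    p ∣ tuplePoly (insert h₀ G) x ↔ p ∣ x + h₀ ∨ p ∣ tuplePoly G x := by
  simp only [prime_dvd_tuplePoly_iff hp, Finset.mem_insert, or_and_right, exists_or, exists_eq_left]

/-- **(9.9)**: "if `h₀` is distinct modulo `p` from all the `h_j ∈ G` then all `ν_p(G)` residue
classes satisfy the relatively prime condition, while otherwise … leaving `ν_p(G) − 1`": in either
case `#{x < p : p ∣ P_G(x), p ∤ x + h₀} = ν_p(G⁰) − 1 = ν*_p(G⁰)`.
[cite: GoldstonPintzYildirim2009, Section 9 eq. 9.9] -/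
theorem card_filter_range_prime_dvd_not_dvd {p : ℕ} (hp : p.Prime) (h₀ : ℕ) (G : Finset ℕ) :
    #((range p).filter fun x => p ∣ tuplePoly G x ∧ ¬ p ∣ x + h₀) = nuStarPrime h₀ G p := by
  classical
  set A := (range p).filter fun x => p ∣ tuplePoly G x with hA
  set A0 := (range p).filter fun x => p ∣ tuplePoly (insert h₀ G) x with hA0
  set B := (range p).filter fun x => p ∣ x + h₀ with hB
  have hA0eq : A0 = B ∪ A := by
    rw [hA0, hB, hA, ← Finset.filter_or]
    exact Finset.filter_congr fun x _ => prime_dvd_tuplePoly_insert_iff hp h₀ G x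
  have hT : ((range p).filter fun x => p ∣ tuplePoly G x ∧ ¬ p ∣ x + h₀) = A0 \ B := by
    rw [hA0eq, Finset.union_sdiff_left, hA, hB, Finset.sdiff_eq_filter, Finset.filter_filter]
    refine Finset.filter_congr fun x hx => ?_
    simp only [Finset.mem_filter, hx, true_and]
  have hBsub : B ⊆ A0 := by rw [hA0eq]; exact Finset.subset_union_left
  rw [hT, Finset.card_sdiff_of_subset hBsub, hA0, card_filter_range_prime_dvd hp, hB,
    card_filter_range_prime_dvd_add hp, nuStarPrime]

/-- The two-set analogue: `#{x < p : p ∣ P_{H₁}(x), p ∣ P_{H₂}(x), p ∤ x + h₀} = ν̄_p(H₁⁰ ∩̄ H₂⁰) − 1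
= ν̄*_p((H₁ ∩̄ H₂)⁰)`. [cite: GoldstonPintzYildirim2009, Section 9 eq. 9.10] -/
theorem card_filter_range_prime_dvd_and_not_dvd {p : ℕ} (hp : p.Prime) (h₀ : ℕ)
    (H₁ H₂ : Finset ℕ) :
    #((range p).filter fun x => (p ∣ tuplePoly H₁ x ∧ p ∣ tuplePoly H₂ x) ∧ ¬ p ∣ x + h₀) =
      nuBarStar h₀ H₁ H₂ p := by
  classical
  set A12 := (range p).filter fun x => p ∣ tuplePoly H₁ x ∧ p ∣ tuplePoly H₂ x with hA12
  set A0 := (range p).filter fun x =>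
    p ∣ tuplePoly (insert h₀ H₁) x ∧ p ∣ tuplePoly (insert h₀ H₂) x with hA0
  set B := (range p).filter fun x => p ∣ x + h₀ with hB
  have hA0eq : A0 = B ∪ A12 := by
    rw [hA0, hB, hA12, ← Finset.filter_or]
    refine Finset.filter_congr fun x _ => ?_
    rw [prime_dvd_tuplePoly_insert_iff hp, prime_dvd_tuplePoly_insert_iff hp]
    tauto
  have hT : ((range p).filter fun x => (p ∣ tuplePoly H₁ x ∧ p ∣ tuplePoly H₂ x) ∧ ¬ p ∣ x + h₀) =
      A0 \ B := by
    rw [hA0eq, Finset.union_sdiff_left, hA12, hB, Finset.sdiff_eq_filter, Finset.filter_filter]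
    refine Finset.filter_congr fun x hx => ?_
    simp only [Finset.mem_filter, hx, true_and]
  have hBsub : B ⊆ A0 := by rw [hA0eq]; exact Finset.subset_union_left
  rw [hT, Finset.card_sdiff_of_subset hBsub, hA0, card_filter_range_prime_dvd_and hp, hB,
    card_filter_range_prime_dvd_add hp, nuBarStar]

/-- `ν_p(G⁰) ≥ 1` (the class of `h₀`). [folklore] -/
theorem one_le_nuPrime_insert (h₀ : ℕ) (G : Finset ℕ) (p : ℕ) : 1 ≤ nuPrime (insert h₀ G) p := by
  unfold nuPrime
  exact Finset.card_pos.2 ⟨h₀ % p, Finset.mem_image.2 ⟨h₀, Finset.mem_insert_self _ _, rfl⟩⟩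

/-- `ν̄_p(H₁⁰ ∩̄ H₂⁰) ≥ 1` (the class of `h₀` is common). [folklore] -/
theorem one_le_nuBar_insert (h₀ : ℕ) (H₁ H₂ : Finset ℕ) (p : ℕ) :
    1 ≤ nuBar (insert h₀ H₁) (insert h₀ H₂) p := by
  rw [nuBar_eq_card_inter]
  refine Finset.card_pos.2 ⟨h₀ % p, Finset.mem_inter.2 ⟨?_, ?_⟩⟩ <;>
    exact Finset.mem_image.2 ⟨h₀, Finset.mem_insert_self _ _, rfl⟩

/-- GPY's expression for `ν̄*`: "we define `ν̄*_d((H₁ ∩̄ H₂)⁰)` as in (7.5)", i.e.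
`ν̄*_p = ν*_p(H₁⁰) + ν*_p(H₂⁰) − ν*_p(H⁰)` with `H⁰ = H₁⁰ ∪ H₂⁰`; in `ℕ` with the subtraction
harmless (`ν*_p(H⁰) ≤ ν*_p(H₁⁰) + ν*_p(H₂⁰)`, stated additively).
[cite: GoldstonPintzYildirim2009, Section 9 eq. 9.10] -/
theorem nuBarStar_eq (h₀ : ℕ) (H₁ H₂ : Finset ℕ) (p : ℕ) :
    nuBarStar h₀ H₁ H₂ p + nuStarPrime h₀ (H₁ ∪ H₂) p =
      nuStarPrime h₀ H₁ p + nuStarPrime h₀ H₂ p := by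
  have hu : insert h₀ (H₁ ∪ H₂) = insert h₀ H₁ ∪ insert h₀ H₂ := by
    ext x; simp only [Finset.mem_insert, Finset.mem_union]; tauto
  have h1 := one_le_nuPrime_insert h₀ H₁ p
  have h2 := one_le_nuPrime_insert h₀ H₂ p
  have h3 := one_le_nuPrime_insert h₀ (H₁ ∪ H₂) p
  have h12 := one_le_nuBar_insert h₀ H₁ H₂ p
  have hle := nuPrime_union_le (insert h₀ H₁) (insert h₀ H₂) p
  rw [hu] at h3
  simp only [nuBarStar, nuStarPrime, nuBar, hu] at h12 ⊢
  generalize nuPrime (insert h₀ H₁) p = a at *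
  generalize nuPrime (insert h₀ H₂) p = b at *
  generalize nuPrime (insert h₀ H₁ ∪ insert h₀ H₂) p = c at *
  omega

/-- The local count with the coprimality condition equals `nuJointStarPrime` (a prime `p`
dividing `d` or `e`). [cite: GoldstonPintzYildirim2009, Section 9 eq. 9.11] -/
theorem card_filter_range_jointCondStar {p : ℕ} (hp : p.Prime) (h₀ : ℕ) (H₁ H₂ : Finset ℕ)
    {d e : ℕ} (hpde : p ∣ d ∨ p ∣ e) :
    #((range p).filter fun x =>
        ((p ∣ d → p ∣ tuplePoly H₁ x) ∧ (p ∣ e → p ∣ tuplePoly H₂ x)) ∧ ¬ p ∣ x + h₀) =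
      nuJointStarPrime h₀ H₁ H₂ d e p := by
  unfold nuJointStarPrime
  by_cases hd : p ∣ d <;> by_cases he : p ∣ e
  · rw [if_pos hd, if_pos he, ← card_filter_range_prime_dvd_and_not_dvd hp h₀ H₁ H₂]
    congr 1
    exact Finset.filter_congr fun x _ => by simp [hd, he]
  · rw [if_pos hd, if_neg he, ← card_filter_range_prime_dvd_not_dvd hp h₀ H₁]
    congr 1
    exact Finset.filter_congr fun x _ => by simp [hd, he]
  · rw [if_neg hd, ← card_filter_range_prime_dvd_not_dvd hp h₀ H₂]
    congr 1
    exact Finset.filter_congr fun x _ => by simp [hd, he]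
  · exact absurd hpde (by tauto)

/-! ### The count modulo `[d, e]` with the coprimality condition (CRT) -/

/-- For `m ≠ 0`: `(a, m) = 1` iff no prime factor of `m` divides `a`. [folklore] -/
theorem coprime_iff_forall_primeFactors_not_dvd {m : ℕ} (hm : m ≠ 0) (a : ℕ) :
    Nat.Coprime a m ↔ ∀ p ∈ m.primeFactors, ¬ p ∣ a := by
  constructor
  · intro h p hp hpa
    have h1 := Nat.eq_one_of_dvd_coprimes h hpa (Nat.dvd_of_mem_primeFactors hp)
    exact (Nat.prime_of_mem_primeFactors hp).one_lt.ne' h1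
  · intro h
    refine Nat.coprime_of_dvd fun k hk hka hkm => ?_
    exact h k (Nat.mem_primeFactors.2 ⟨hk, hkm, hm⟩) hka

/-- `p ∣ (t mod p) + h₀ ↔ p ∣ t + h₀`. [folklore] -/
theorem dvd_mod_add_iff (p t h₀ : ℕ) : p ∣ t % p + h₀ ↔ p ∣ t + h₀ := by
  rw [Nat.dvd_iff_mod_eq_zero, Nat.dvd_iff_mod_eq_zero, Nat.add_mod, Nat.mod_mod, ← Nat.add_mod]

/-- **The count behind (9.9)–(9.11)**: for squarefree `d`, `e`, the number of classes
`r (mod [d, e])` with `d ∣ P_{H₁}(r)`, `e ∣ P_{H₂}(r)` and `(r + h₀, [d, e]) = 1` is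
`nuJointStar h₀ H₁ H₂ d e = ν*_{a₁}(H₁⁰) ν*_{a₂}(H₂⁰) ν̄*_{a₁₂}((H₁ ∩̄ H₂)⁰)` ("the divisibility
conditions … are handled as in Section 7 together with the above considerations"), by the Chinese
remainder theorem (`sum_range_prod_eq_prod_sum`). [cite: GoldstonPintzYildirim2009, Section 9 eq. 9.11] -/
theorem card_filter_range_lcm_coprime {d e : ℕ} (hd : Squarefree d) (he : Squarefree e)
    (h₀ : ℕ) (H₁ H₂ : Finset ℕ) :
    #((range (Nat.lcm d e)).filter fun r =>
        (d ∣ tuplePoly H₁ r ∧ e ∣ tuplePoly H₂ r) ∧ Nat.Coprime (r + h₀) (Nat.lcm d e)) =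
      nuJointStar h₀ H₁ H₂ d e := by
  classical
  have hd0 := hd.ne_zero
  have he0 := he.ne_zero
  set m := Nat.lcm d e with hmdef
  have hm0 : m ≠ 0 := Nat.lcm_ne_zero hd0 he0
  have hmsq : Squarefree m := by
    -- as in `card_filter_range_lcm` (= `MaynardSieve.squarefree_lcm`, not imported here)
    rw [Nat.squarefree_iff_factorization_le_one hm0]
    intro p
    rw [hmdef, Nat.factorization_lcm hd0 he0, Finsupp.sup_apply]
    exact sup_le ((Nat.squarefree_iff_factorization_le_one hd0).mp hd p)
      ((Nat.squarefree_iff_factorization_le_one he0).mp he p)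
  set S := m.primeFactors with hSdef
  have hS : ∀ p ∈ S, p.Prime := fun p hp => Nat.prime_of_mem_primeFactors hp
  have hprod : ∏ p ∈ S, p = m := Nat.prod_primeFactors_of_squarefree hmsq
  have hpde : ∀ p ∈ S, p ∣ d ∨ p ∣ e := fun p hp =>
    (Nat.Prime.dvd_mul (Nat.prime_of_mem_primeFactors hp)).1
      ((Nat.dvd_of_mem_primeFactors hp).trans (Nat.lcm_dvd_mul d e))
  set g : ℕ → ℕ → ℝ := fun p r =>
    if ((p ∣ d → p ∣ tuplePoly H₁ r) ∧ (p ∣ e → p ∣ tuplePoly H₂ r)) ∧ ¬ p ∣ r + h₀ then 1 else 0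
    with hgdef
  have hg : ∀ p ∈ S, ∀ t, g p (t % p) = g p t := by
    intro p _ t
    simp only [hgdef, jointCond_mod_iff, dvd_mod_add_iff]
  have key := sum_range_prod_eq_prod_sum S hS g hg
  rw [hprod] at key
  have hL : ∀ r, ∏ p ∈ S, g p r =
      if (d ∣ tuplePoly H₁ r ∧ e ∣ tuplePoly H₂ r) ∧ Nat.Coprime (r + h₀) m then 1 else 0 := by
    intro r
    simp only [hgdef]
    rw [Finset.prod_boole]
    congr 1
    rw [dvd_and_dvd_iff hd he H₁ H₂ r, coprime_iff_forall_primeFactors_not_dvd hm0]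
    exact propext ⟨fun h => ⟨fun p hp => (h p hp).1, fun p hp => (h p hp).2⟩,
      fun h p hp => ⟨h.1 p hp, h.2 p hp⟩⟩
  have hRp : ∀ p ∈ S, ∑ x ∈ range p, g p x = nuJointStarPrime h₀ H₁ H₂ d e p := by
    intro p hp
    simp only [hgdef]
    rw [Finset.sum_boole, card_filter_range_jointCondStar (hS p hp) h₀ H₁ H₂ (hpde p hp)]
  simp_rw [hL] at key
  rw [Finset.sum_boole, Finset.prod_congr rfl hRp] at key
  unfold nuJointStar
  exact_mod_cast key

/-- The classes counted by `nuJointStar` are among those counted by `nuJoint`: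
`nuJointStar ≤ nuJoint`. [folklore] -/
theorem nuJointStar_le_nuJoint {d e : ℕ} (hd : Squarefree d) (he : Squarefree e) (h₀ : ℕ)
    (H₁ H₂ : Finset ℕ) : nuJointStar h₀ H₁ H₂ d e ≤ nuJoint H₁ H₂ d e := by
  classical
  rw [← card_filter_range_lcm_coprime hd he, ← card_filter_range_lcm hd he]
  exact Finset.card_le_card (Finset.monotone_filter_right _ fun r _ h => h.1)

/-- `ν*_d(G⁰) = ∏_{p ∣ d} ν*_p(G⁰)`: "we extend this definition to `ν*_d(H₁⁰)` for squarefree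
numbers `d` by multiplicativity" (GPY after (9.10); junk on non-squarefree `d`).
[cite: GoldstonPintzYildirim2009, Section 9 eq. 9.10] -/
def nuStar (h₀ : ℕ) (G : Finset ℕ) (d : ℕ) : ℕ := ∏ p ∈ d.primeFactors, nuStarPrime h₀ G p

/-- **GPY's form of the twisted count** ((9.11)/(9.12)): for squarefree `d = a₁a₁₂`, `e = a₂a₁₂`
with `a₁₂ = (d, e)`, `a₁ = d/a₁₂`, `a₂ = e/a₁₂` (pairwise coprime),
`nuJointStar h₀ H₁ H₂ d e = ν*_{a₁}(H₁⁰) · ν*_{a₂}(H₂⁰) · ∏_{p ∣ a₁₂} ν̄*_p((H₁ ∩̄ H₂)⁰)`, the last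
factor being the multiplicative extension `ν̄*_{a₁₂}((H₁ ∩̄ H₂)⁰)`; the twisted twin of
`nuJoint_eq` (same partition of the primes of `[d, e]`).
[cite: GoldstonPintzYildirim2009, Section 9 eq. 9.11] -/
theorem nuJointStar_eq {d e : ℕ} (hd : Squarefree d) (he : Squarefree e) (h₀ : ℕ)
    (H₁ H₂ : Finset ℕ) :
    nuJointStar h₀ H₁ H₂ d e = nuStar h₀ H₁ (d / Nat.gcd d e) * nuStar h₀ H₂ (e / Nat.gcd d e) *
      ∏ p ∈ (Nat.gcd d e).primeFactors, nuBarStar h₀ H₁ H₂ p := by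
  classical
  have hd0 := hd.ne_zero
  have he0 := he.ne_zero
  set g := Nat.gcd d e with hgdef
  have hg0 : g ≠ 0 := (Nat.gcd_pos_of_pos_left e (Nat.pos_of_ne_zero hd0)).ne'
  have hdg0 : d / g ≠ 0 := (Nat.div_pos (Nat.le_of_dvd (Nat.pos_of_ne_zero hd0)
    (Nat.gcd_dvd_left d e)) (Nat.pos_of_ne_zero hg0)).ne'
  have heg0 : e / g ≠ 0 := (Nat.div_pos (Nat.le_of_dvd (Nat.pos_of_ne_zero he0)
    (Nat.gcd_dvd_right d e)) (Nat.pos_of_ne_zero hg0)).ne'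
  have hl0 : Nat.lcm d e ≠ 0 := Nat.lcm_ne_zero hd0 he0
  -- membership descriptions (as in `nuJoint_eq`)
  have hA₁ : ∀ p, p ∈ (d / g).primeFactors ↔ p.Prime ∧ p ∣ d ∧ ¬ p ∣ e := fun p => by
    rw [Nat.mem_primeFactors_of_ne_zero hdg0]
    constructor
    · rintro ⟨hp, h⟩; exact ⟨hp, (prime_dvd_div_gcd_iff hd hp).1 h⟩
    · rintro ⟨hp, h⟩; exact ⟨hp, (prime_dvd_div_gcd_iff hd hp).2 h⟩
  have hA₂ : ∀ p, p ∈ (e / g).primeFactors ↔ p.Prime ∧ p ∣ e ∧ ¬ p ∣ d := fun p => by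
    rw [Nat.mem_primeFactors_of_ne_zero heg0, hgdef, Nat.gcd_comm]
    constructor
    · rintro ⟨hp, h⟩; exact ⟨hp, (prime_dvd_div_gcd_iff he hp).1 h⟩
    · rintro ⟨hp, h⟩; exact ⟨hp, (prime_dvd_div_gcd_iff he hp).2 h⟩
  have hA₁₂ : ∀ p, p ∈ g.primeFactors ↔ p.Prime ∧ p ∣ d ∧ p ∣ e := fun p => by
    rw [Nat.mem_primeFactors_of_ne_zero hg0, hgdef, Nat.dvd_gcd_iff]
  have hS : ∀ p, p ∈ (Nat.lcm d e).primeFactors ↔ p.Prime ∧ (p ∣ d ∨ p ∣ e) := fun p => by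
    rw [Nat.mem_primeFactors_of_ne_zero hl0]
    constructor
    · rintro ⟨hp, h⟩
      exact ⟨hp, (Nat.Prime.dvd_mul hp).1 (h.trans (Nat.lcm_dvd_mul d e))⟩
    · rintro ⟨hp, h | h⟩
      · exact ⟨hp, h.trans (Nat.dvd_lcm_left d e)⟩
      · exact ⟨hp, h.trans (Nat.dvd_lcm_right d e)⟩
  -- the partition
  have hunion : (Nat.lcm d e).primeFactors =
      ((d / g).primeFactors ∪ (e / g).primeFactors) ∪ g.primeFactors := by
    ext p
    simp only [Finset.mem_union, hA₁, hA₂, hA₁₂, hS]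
    tauto
  have hdisj1 : Disjoint (d / g).primeFactors (e / g).primeFactors := by
    rw [Finset.disjoint_left]
    intro p h1 h2
    rw [hA₁] at h1; rw [hA₂] at h2
    exact h1.2.2 h2.2.1
  have hdisj2 : Disjoint ((d / g).primeFactors ∪ (e / g).primeFactors) g.primeFactors := by
    rw [Finset.disjoint_left]
    intro p h12 h3
    rw [hA₁₂] at h3
    rcases Finset.mem_union.1 h12 with h1 | h2
    · rw [hA₁] at h1; exact h1.2.2 h3.2.2
    · rw [hA₂] at h2; exact h2.2.2 h3.2.1
  unfold nuJointStar nuStar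
  rw [hunion, Finset.prod_union hdisj2, Finset.prod_union hdisj1]
  congr 1
  · congr 1
    · refine Finset.prod_congr rfl fun p hp => ?_
      rw [hA₁] at hp
      simp [nuJointStarPrime, hp.2.1, hp.2.2]
    · refine Finset.prod_congr rfl fun p hp => ?_
      rw [hA₂] at hp
      simp [nuJointStarPrime, hp.2.2]
  · refine Finset.prod_congr rfl fun p hp => ?_
    rw [hA₁₂] at hp
    simp [nuJointStarPrime, hp.2.1, hp.2.2]

/-! ### (9.7): expanding `S̃_R` over pairs of divisors -/

/-- One summand of (9.7): `Λ_R(n;H₁,ℓ₁)Λ_R(n;H₂,ℓ₂) w` expanded over pairs `(d, e)` (any weight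
`w`; `lambdaR_mul_lambdaR_eq` is `w = 1`). [cite: GoldstonPintzYildirim2009, Section 9 eq. 9.7] -/
theorem lambdaR_mul_lambdaR_mul_eq (R : ℝ) (H₁ H₂ : Finset ℕ) (ℓ₁ ℓ₂ : ℕ) {n : ℕ} (hn : 1 ≤ n)
    (w : ℝ) :
    lambdaR R H₁ ℓ₁ n * lambdaR R H₂ ℓ₂ n * w =
      ((#H₁ + ℓ₁).factorial : ℝ)⁻¹ * ((#H₂ + ℓ₂).factorial : ℝ)⁻¹ *
        ∑ de ∈ Icc 1 ⌊R⌋₊ ×ˢ Icc 1 ⌊R⌋₊,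
          if de.1 ∣ tuplePoly H₁ n ∧ de.2 ∣ tuplePoly H₂ n then
            (μ de.1 : ℝ) * (μ de.2 : ℝ) * Real.log (R / de.1) ^ (#H₁ + ℓ₁) *
              Real.log (R / de.2) ^ (#H₂ + ℓ₂) * w else 0 := by
  rw [lambdaR_mul_lambdaR_eq R H₁ H₂ ℓ₁ ℓ₂ hn, mul_assoc, Finset.sum_mul]
  congr 1
  refine Finset.sum_congr rfl fun de _ => ?_
  split_ifs <;> simp

/-- **GPY (9.7)**: `S̃_R(N; H₁, H₂, ℓ₁, ℓ₂, h₀) := ∑_{n=1}^N Λ_R(n;H₁,ℓ₁)Λ_R(n;H₂,ℓ₂)θ(n+h₀) =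
(1/((k₁+ℓ₁)!(k₂+ℓ₂)!)) ∑_{d,e ≤ R} μ(d)μ(e)(log R/d)^{k₁+ℓ₁}(log R/e)^{k₂+ℓ₂}
∑_{1 ≤ n ≤ N, d∣P_{H₁}(n), e∣P_{H₂}(n)} θ(n+h₀)`. [cite: GoldstonPintzYildirim2009, Section 9 eq. 9.7] -/
theorem sum_lambdaR_mul_theta_eq (R : ℝ) (H₁ H₂ : Finset ℕ) (ℓ₁ ℓ₂ N h₀ : ℕ) :
    ∑ n ∈ Icc 1 N, lambdaR R H₁ ℓ₁ n * lambdaR R H₂ ℓ₂ n * theta (n + h₀) =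
      ((#H₁ + ℓ₁).factorial : ℝ)⁻¹ * ((#H₂ + ℓ₂).factorial : ℝ)⁻¹ *
        ∑ de ∈ Icc 1 ⌊R⌋₊ ×ˢ Icc 1 ⌊R⌋₊,
          (μ de.1 : ℝ) * (μ de.2 : ℝ) * Real.log (R / de.1) ^ (#H₁ + ℓ₁) *
            Real.log (R / de.2) ^ (#H₂ + ℓ₂) *
            ∑ n ∈ (Icc 1 N).filter (fun n => de.1 ∣ tuplePoly H₁ n ∧ de.2 ∣ tuplePoly H₂ n),
              theta (n + h₀) := by
  rw [Finset.sum_congr rfl fun n hn =>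
      lambdaR_mul_lambdaR_mul_eq R H₁ H₂ ℓ₁ ℓ₂ (Finset.mem_Icc.1 hn).1 (theta (n + h₀)),
    ← Finset.mul_sum, Finset.sum_comm]
  congr 1
  refine Finset.sum_congr rfl fun de _ => ?_
  rw [Finset.sum_filter, Finset.mul_sum]
  refine Finset.sum_congr rfl fun n _ => ?_
  split_ifs <;> simp

/-! ### (9.8): the classes modulo `m = [d, e]` and the shift `n ↦ n + h₀` -/

/-- `θ(x) ≤ log T` for `x ≤ T` (`θ(0) = θ(1) = 0`). [folklore] -/
theorem theta_le_log_of_le {x T : ℕ} (hx : x ≤ T) : theta x ≤ Real.log T := by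
  rcases Nat.eq_zero_or_pos x with rfl | hx0
  · rw [theta_of_not_prime Nat.not_prime_zero]
    exact Real.log_natCast_nonneg T
  · exact (theta_le_log x).trans (Real.log_le_log (by exact_mod_cast hx0) (by exact_mod_cast hx))

/-- `∑_{x ∈ s} θ(x) ≤ #s · log T` when `s ⊆ [0, T]`. [folklore] -/
theorem sum_theta_le_card_mul_log {s : Finset ℕ} {T : ℕ} (hs : ∀ x ∈ s, x ≤ T) :
    ∑ x ∈ s, theta x ≤ #s * Real.log T := by
  calc ∑ x ∈ s, theta x ≤ ∑ _x ∈ s, Real.log T :=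
        Finset.sum_le_sum fun x hx => theta_le_log_of_le (hs x hx)
    _ = #s * Real.log T := by rw [Finset.sum_const, nsmul_eq_mul]

/-- The inner sum of (9.7) split according to the residue class of `n` modulo `m = [d, e]` ("the
`n` for which `d ∣ P_{H₁}(n)` and `e ∣ P_{H₂}(n)` cover certain residue classes modulo `[d, e]`",
GPY §9 after (9.7)). [cite: GoldstonPintzYildirim2009, Section 9 eq. 9.8] -/
theorem sum_filter_theta_eq_sum_classes {d e : ℕ} (hd : Squarefree d) (he : Squarefree e)
    (H₁ H₂ : Finset ℕ) (N h₀ : ℕ) :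
    ∑ n ∈ (Icc 1 N).filter (fun n => d ∣ tuplePoly H₁ n ∧ e ∣ tuplePoly H₂ n), theta (n + h₀) =
      ∑ b ∈ (range (Nat.lcm d e)).filter (fun r => d ∣ tuplePoly H₁ r ∧ e ∣ tuplePoly H₂ r),
        ∑ n ∈ (Icc 1 N).filter (fun n => n % Nat.lcm d e = b), theta (n + h₀) := by
  classical
  have hm0 : 0 < Nat.lcm d e := Nat.pos_of_ne_zero (Nat.lcm_ne_zero hd.ne_zero he.ne_zero)
  have hmaps : ∀ n ∈ (Icc 1 N).filter (fun n => d ∣ tuplePoly H₁ n ∧ e ∣ tuplePoly H₂ n),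
      n % Nat.lcm d e ∈ range (Nat.lcm d e) := fun n _ => mem_range.2 (Nat.mod_lt _ hm0)
  rw [← Finset.sum_fiberwise_of_maps_to hmaps, Finset.sum_filter]
  refine Finset.sum_congr rfl fun b _ => ?_
  by_cases hcond : d ∣ tuplePoly H₁ b ∧ e ∣ tuplePoly H₂ b
  · rw [if_pos hcond, Finset.filter_filter]
    refine Finset.sum_congr (Finset.filter_congr fun n _ => ⟨fun h => h.2, fun h => ⟨?_, h⟩⟩)
      fun _ _ => rfl
    have h' := (dvd_and_dvd_mod_iff hd he H₁ H₂ n)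
    rw [h] at h'
    exact h'.1 hcond
  · rw [if_neg hcond]
    refine Finset.sum_eq_zero fun n hn => ?_
    exfalso
    rw [Finset.filter_filter, Finset.mem_filter] at hn
    have h' := (dvd_and_dvd_mod_iff hd he H₁ H₂ n).2 hn.2.1
    rw [hn.2.2] at h'
    exact hcond h'

/-- Upper half of **(9.8)**: for the class `b`,
`∑_{1 ≤ n ≤ N, n ≡ b (m)} θ(n + h₀) ≤ θ(N; m, b + h₀) + h₀ log(N + h₀)`
(`= θ(N + h₀; m, b + h₀) − θ(h₀; m, b + h₀)`, and `θ(N + h₀; ·) − θ(N; ·) ≤ h₀ log(N + h₀)`).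
[cite: GoldstonPintzYildirim2009, Section 9 eq. 9.8] -/
theorem sum_class_theta_le (m N h₀ b : ℕ) :
    ∑ n ∈ (Icc 1 N).filter (fun n => n % m = b), theta (n + h₀) ≤
      thetaMod N m ((b + h₀ : ℕ) : ZMod m) + h₀ * Real.log ((N + h₀ : ℕ) : ℝ) := by
  classical
  set S := (Icc 1 N).filter (fun n => n % m = b) with hS
  set f : ℕ ↪ ℕ := ⟨fun n => n + h₀, add_left_injective h₀⟩ with hf
  set cls : ℕ → Prop := fun x => (x : ZMod m) = ((b + h₀ : ℕ) : ZMod m) with hcls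
  have h1 : ∑ n ∈ S, theta (n + h₀) = ∑ x ∈ S.map f, theta x := by
    rw [Finset.sum_map]; rfl
  have hsub : S.map f ⊆ (Icc 1 (N + h₀)).filter cls := by
    intro x hx
    rw [Finset.mem_map] at hx
    obtain ⟨n, hn, rfl⟩ := hx
    rw [hS, Finset.mem_filter, Finset.mem_Icc] at hn
    rw [Finset.mem_filter, Finset.mem_Icc]
    have hnb : (n : ZMod m) = (b : ZMod m) := by
      rw [ZMod.natCast_eq_natCast_iff', ← hn.2, Nat.mod_mod]
    refine ⟨⟨?_, ?_⟩, ?_⟩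
    · show 1 ≤ n + h₀; omega
    · show n + h₀ ≤ N + h₀; omega
    · show ((n + h₀ : ℕ) : ZMod m) = ((b + h₀ : ℕ) : ZMod m)
      push_cast; rw [hnb]
  have hsplit : (Icc 1 (N + h₀)).filter cls =
      (Icc 1 N).filter cls ∪ (Ioc N (N + h₀)).filter cls := by
    rw [← Finset.filter_union]
    congr 1
    ext x; simp only [Finset.mem_Icc, Finset.mem_union, Finset.mem_Ioc]; omega
  have hdisj : Disjoint ((Icc 1 N).filter cls) ((Ioc N (N + h₀)).filter cls) := by
    apply Finset.disjoint_filter_filter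
    rw [Finset.disjoint_left]
    intro x hx hx'
    rw [Finset.mem_Icc] at hx; rw [Finset.mem_Ioc] at hx'; omega
  have htail : ∑ x ∈ (Ioc N (N + h₀)).filter cls, theta x ≤ h₀ * Real.log ((N + h₀ : ℕ) : ℝ) := by
    calc ∑ x ∈ (Ioc N (N + h₀)).filter cls, theta x ≤ ∑ x ∈ Ioc N (N + h₀), theta x :=
          Finset.sum_le_sum_of_subset_of_nonneg (Finset.filter_subset _ _)
            (fun x _ _ => theta_nonneg x)
      _ ≤ #(Ioc N (N + h₀)) * Real.log ((N + h₀ : ℕ) : ℝ) :=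
          sum_theta_le_card_mul_log (fun x hx => (Finset.mem_Ioc.1 hx).2)
      _ = h₀ * Real.log ((N + h₀ : ℕ) : ℝ) := by
          rw [Nat.card_Ioc, Nat.add_sub_cancel_left]
  calc ∑ n ∈ S, theta (n + h₀) = ∑ x ∈ S.map f, theta x := h1
    _ ≤ ∑ x ∈ (Icc 1 (N + h₀)).filter cls, theta x :=
        Finset.sum_le_sum_of_subset_of_nonneg hsub (fun x _ _ => theta_nonneg x)
    _ = thetaMod N m ((b + h₀ : ℕ) : ZMod m) + ∑ x ∈ (Ioc N (N + h₀)).filter cls, theta x := by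
        rw [hsplit, Finset.sum_union hdisj]; rfl
    _ ≤ _ := by linarith [htail]

/-- Lower half of **(9.8)**: for a class `b < m`,
`θ(N; m, b + h₀) ≤ ∑_{1 ≤ n ≤ N, n ≡ b (m)} θ(n + h₀) + h₀ log(N + h₀)`
(the terms `m' ≤ h₀` of `θ(N; m, b + h₀)`, i.e. `θ(h₀; m, b + h₀) ≤ h₀ log h₀`, are the only ones
not of the form `n + h₀`). [cite: GoldstonPintzYildirim2009, Section 9 eq. 9.8] -/
theorem thetaMod_le_sum_class_add {m b : ℕ} (hb : b < m) (N h₀ : ℕ) :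
    thetaMod N m ((b + h₀ : ℕ) : ZMod m) ≤
      ∑ n ∈ (Icc 1 N).filter (fun n => n % m = b), theta (n + h₀) +
        h₀ * Real.log ((N + h₀ : ℕ) : ℝ) := by
  classical
  set S := (Icc 1 N).filter (fun n => n % m = b) with hS
  set f : ℕ ↪ ℕ := ⟨fun n => n + h₀, add_left_injective h₀⟩ with hf
  set cls : ℕ → Prop := fun x => (x : ZMod m) = ((b + h₀ : ℕ) : ZMod m) with hcls
  have hsub : (Icc 1 N).filter cls ⊆ S.map f ∪ Icc 1 h₀ := by
    intro x hx
    rw [Finset.mem_filter, Finset.mem_Icc] at hx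
    rw [Finset.mem_union]
    by_cases hxh : h₀ < x
    · left
      rw [Finset.mem_map]
      refine ⟨x - h₀, ?_, ?_⟩
      · rw [hS, Finset.mem_filter, Finset.mem_Icc]
        refine ⟨⟨by omega, by omega⟩, ?_⟩
        have hcast : ((x - h₀ : ℕ) : ZMod m) = (b : ZMod m) := by
          have h2 : ((x - h₀ : ℕ) : ZMod m) + (h₀ : ZMod m) = (b : ZMod m) + (h₀ : ZMod m) := by
            rw [← Nat.cast_add, ← Nat.cast_add, Nat.sub_add_cancel hxh.le]; exact hx.2
          exact add_right_cancel h2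
        rw [ZMod.natCast_eq_natCast_iff'] at hcast
        rw [hcast, Nat.mod_eq_of_lt hb]
      · show x - h₀ + h₀ = x; omega
    · right; rw [Finset.mem_Icc]; omega
  have hsmall : ∑ x ∈ Icc 1 h₀, theta x ≤ h₀ * Real.log ((N + h₀ : ℕ) : ℝ) := by
    calc ∑ x ∈ Icc 1 h₀, theta x ≤ #(Icc 1 h₀) * Real.log ((N + h₀ : ℕ) : ℝ) :=
          sum_theta_le_card_mul_log (fun x hx => by rw [Finset.mem_Icc] at hx; omega)
      _ = h₀ * Real.log ((N + h₀ : ℕ) : ℝ) := by rw [Nat.card_Icc, Nat.add_sub_cancel]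
  have hmap : ∑ x ∈ S.map f, theta x = ∑ n ∈ S, theta (n + h₀) := by rw [Finset.sum_map]; rfl
  calc thetaMod N m ((b + h₀ : ℕ) : ZMod m) = ∑ x ∈ (Icc 1 N).filter cls, theta x := rfl
    _ ≤ ∑ x ∈ S.map f ∪ Icc 1 h₀, theta x :=
        Finset.sum_le_sum_of_subset_of_nonneg hsub (fun x _ _ => theta_nonneg x)
    _ ≤ ∑ x ∈ S.map f, theta x + ∑ x ∈ Icc 1 h₀, theta x := by
        have h := Finset.sum_union_inter (s₁ := S.map f) (s₂ := Icc 1 h₀) (f := theta)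
        have h0 : 0 ≤ ∑ x ∈ S.map f ∩ Icc 1 h₀, theta x :=
          Finset.sum_nonneg fun x _ => theta_nonneg x
        linarith
    _ ≤ _ := by rw [hmap]; linarith [hsmall]

/-- The two halves of (9.8) together: for a class `b < m`,
`|∑_{1 ≤ n ≤ N, n ≡ b (m)} θ(n + h₀) − θ(N; m, b + h₀)| ≤ h₀ log(N + h₀)` — the `O(h log N)` of (9.8).
[cite: GoldstonPintzYildirim2009, Section 9 eq. 9.8] -/
theorem abs_sum_class_theta_sub_thetaMod_le {m b : ℕ} (hb : b < m) (N h₀ : ℕ) :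
    |∑ n ∈ (Icc 1 N).filter (fun n => n % m = b), theta (n + h₀) -
        thetaMod N m ((b + h₀ : ℕ) : ZMod m)| ≤ h₀ * Real.log ((N + h₀ : ℕ) : ℝ) := by
  rw [abs_le]
  constructor
  · linarith [thetaMod_le_sum_class_add hb N h₀]
  · linarith [sum_class_theta_le m N h₀ b]

/-! ### Non-coprime classes: "`E(N; q, a) ≪ log N` if `(a, q) > 1`" -/

/-- For a class `a` not coprime to `m ≥ 1`, the only possible prime `≡ a (mod m)` divides `m`, so
`θ(N; m, a) ≤ ∑_{p ∣ m} log p ≤ log m` (GPY: "`E(n; q, a) ≪ log N` if `(a, q) > 1` and `q ≤ N`").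
[cite: GoldstonPintzYildirim2009, Section 9 eq. 9.11] -/
theorem thetaMod_le_log_of_not_coprime {m : ℕ} (hm : m ≠ 0) (N : ℕ) {a : ℕ}
    (ha : ¬ Nat.Coprime a m) : thetaMod N m (a : ZMod m) ≤ Real.log m := by
  set V := (Icc 1 N).filter (fun x : ℕ => (x : ZMod m) = (a : ZMod m)) with hV
  have h1 : thetaMod N m (a : ZMod m) = ∑ x ∈ V.filter Nat.Prime, Real.log x := by
    rw [Finset.sum_filter (p := Nat.Prime)]
    rfl
  have hsub : V.filter Nat.Prime ⊆ m.primeFactors := by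
    intro x hx
    rw [Finset.mem_filter, hV, Finset.mem_filter] at hx
    obtain ⟨⟨-, hxa⟩, hxp⟩ := hx
    rw [ZMod.natCast_eq_natCast_iff'] at hxa
    have hg : Nat.gcd x m = Nat.gcd a m := by
      rw [Nat.gcd_comm x m, Nat.gcd_comm a m, Nat.gcd_rec m x, Nat.gcd_rec m a, hxa]
    have hg1 : Nat.gcd x m ≠ 1 := by rw [hg]; exact ha
    have hgx : Nat.gcd x m = x := by
      rcases (Nat.Prime.eq_one_or_self_of_dvd hxp _ (Nat.gcd_dvd_left x m)) with h | h
      · exact absurd h hg1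
      · exact h
    have hxm : x ∣ m := by rw [← hgx]; exact Nat.gcd_dvd_right x m
    exact Nat.mem_primeFactors.2 ⟨hxp, hxm, hm⟩
  have hm0 : (0 : ℝ) < m := by exact_mod_cast Nat.pos_of_ne_zero hm
  calc thetaMod N m (a : ZMod m) = ∑ x ∈ V.filter Nat.Prime, Real.log x := h1
    _ ≤ ∑ p ∈ m.primeFactors, Real.log p :=
        Finset.sum_le_sum_of_subset_of_nonneg hsub (fun p _ _ => Real.log_natCast_nonneg p)
    _ = Real.log ((∏ p ∈ m.primeFactors, p : ℕ) : ℝ) := by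
        push_cast
        rw [Real.log_prod]
        intro p hp
        exact_mod_cast (Nat.prime_of_mem_primeFactors hp).ne_zero
    _ ≤ Real.log m := by
        apply Real.log_le_log
        · exact_mod_cast Finset.prod_pos fun p hp => (Nat.prime_of_mem_primeFactors hp).pos
        · exact_mod_cast Nat.le_of_dvd (Nat.pos_of_ne_zero hm) (Nat.prod_primeFactors_dvd m)

/-! ### (9.11): the inner sum -/

/-- Per class `b < m` (`m ≥ 1`): `∑_{1 ≤ n ≤ N, n ≡ b (m)} θ(n + h₀)` is `[(b + h₀, m) = 1] N/φ(m)`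
up to `E'(N, m) + log m + h₀ log(N + h₀)` ((9.8) with (9.2) on the coprime classes and
`θ(N; m, c) ≤ log m` on the others). [cite: GoldstonPintzYildirim2009, Section 9 eq. 9.11] -/
theorem abs_sum_class_theta_sub_main_le {m b : ℕ} (hm : m ≠ 0) (hb : b < m) (N h₀ : ℕ) :
    |∑ n ∈ (Icc 1 N).filter (fun n => n % m = b), theta (n + h₀) -
        (if Nat.Coprime (b + h₀) m then (N : ℝ) / (Nat.totient m : ℝ) else 0)| ≤
      thetaErr N m + Real.log m + h₀ * Real.log ((N + h₀ : ℕ) : ℝ) := by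
  have hshift := abs_sum_class_theta_sub_thetaMod_le hb N h₀
  have hE0 := thetaErr_nonneg N m
  have hlog0 : 0 ≤ Real.log m := Real.log_natCast_nonneg m
  split_ifs with hcop
  · have hu : ((ZMod.unitOfCoprime (b + h₀) hcop : (ZMod m)ˣ) : ZMod m) = ((b + h₀ : ℕ) : ZMod m) :=
      ZMod.coe_unitOfCoprime (b + h₀) hcop
    have hE := abs_thetaMod_sub_le_thetaErr N m (ZMod.unitOfCoprime (b + h₀) hcop)
    rw [hu] at hE
    calc _ ≤ |∑ n ∈ (Icc 1 N).filter (fun n => n % m = b), theta (n + h₀) -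
              thetaMod N m ((b + h₀ : ℕ) : ZMod m)| +
            |thetaMod N m ((b + h₀ : ℕ) : ZMod m) - (N : ℝ) / (Nat.totient m : ℝ)| :=
          abs_sub_le _ _ _
      _ ≤ _ := by linarith
  · have hT0 : 0 ≤ ∑ n ∈ (Icc 1 N).filter (fun n => n % m = b), theta (n + h₀) :=
      Finset.sum_nonneg fun n _ => theta_nonneg _
    have hθ := thetaMod_le_log_of_not_coprime hm N hcop
    have hup := sum_class_theta_le m N h₀ b
    rw [sub_zero, abs_of_nonneg hT0]
    linarith

/-- **GPY (9.11)** with explicit constants: for squarefree `d`, `e` and `m = [d, e]`,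
`|∑_{1 ≤ n ≤ N, d ∣ P_{H₁}(n), e ∣ P_{H₂}(n)} θ(n + h₀) − ν*_{a₁}(H₁⁰)ν*_{a₂}(H₂⁰)ν̄*_{a₁₂}((H₁∩̄H₂)⁰) N/φ(m)|`
`≤ nuJoint(d, e) · (E'(N, m) + log m + h₀ log(N + h₀))`
(the printed `O(d_k(a₁a₂a₁₂)(E'(N, a₁a₂a₁₂) + h log N))`, with `nuJoint ≤ d_k(d)d_k(e)` by
`nuJoint_le`). [cite: GoldstonPintzYildirim2009, Section 9 eq. 9.11] -/
theorem abs_sum_theta_filter_sub_le {d e : ℕ} (hd : Squarefree d) (he : Squarefree e)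
    (H₁ H₂ : Finset ℕ) (N h₀ : ℕ) :
    |∑ n ∈ (Icc 1 N).filter (fun n => d ∣ tuplePoly H₁ n ∧ e ∣ tuplePoly H₂ n), theta (n + h₀) -
        nuJointStar h₀ H₁ H₂ d e * ((N : ℝ) / (Nat.totient (Nat.lcm d e) : ℝ))| ≤
      nuJoint H₁ H₂ d e *
        (thetaErr N (Nat.lcm d e) + Real.log (Nat.lcm d e) + h₀ * Real.log ((N + h₀ : ℕ) : ℝ)) := by
  classical
  have hm : Nat.lcm d e ≠ 0 := Nat.lcm_ne_zero hd.ne_zero he.ne_zero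
  have hcnt := card_filter_range_lcm_coprime hd he h₀ H₁ H₂
  have hcard := card_filter_range_lcm hd he H₁ H₂
  rw [sum_filter_theta_eq_sum_classes hd he H₁ H₂ N h₀]
  set m := Nat.lcm d e with hmdef
  set C := (range m).filter (fun r => d ∣ tuplePoly H₁ r ∧ e ∣ tuplePoly H₂ r) with hC
  have hmain : (nuJointStar h₀ H₁ H₂ d e : ℝ) * ((N : ℝ) / (Nat.totient m : ℝ)) =
      ∑ b ∈ C, (if Nat.Coprime (b + h₀) m then (N : ℝ) / (Nat.totient m : ℝ) else 0) := by
    rw [← Finset.sum_filter, Finset.sum_const, nsmul_eq_mul, hC, Finset.filter_filter, hcnt]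
  rw [hmain, ← Finset.sum_sub_distrib]
  calc _ ≤ ∑ b ∈ C, |∑ n ∈ (Icc 1 N).filter (fun n => n % m = b), theta (n + h₀) -
          (if Nat.Coprime (b + h₀) m then (N : ℝ) / (Nat.totient m : ℝ) else 0)| :=
        Finset.abs_sum_le_sum_abs _ _
    _ ≤ ∑ _b ∈ C, (thetaErr N m + Real.log m + h₀ * Real.log ((N + h₀ : ℕ) : ℝ)) :=
        Finset.sum_le_sum fun b hb =>
          abs_sum_class_theta_sub_main_le hm (mem_range.1 (Finset.mem_filter.1 hb).1) N h₀
    _ = _ := by rw [Finset.sum_const, nsmul_eq_mul, hcard]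

/-! ### (9.12), first line: `S̃_R = N 𝒯̃_R + O(…)` -/

/-- The main term `𝒯̃_R(H₁, H₂, ℓ₁, ℓ₂, h₀)` of GPY (9.12), written over pairs `(d, e)`:
`(1/((k₁+ℓ₁)!(k₂+ℓ₂)!)) ∑_{d, e ≤ R} μ(d)μ(e)(log R/d)^{k₁+ℓ₁}(log R/e)^{k₂+ℓ₂}`
`· ν*_{a₁}(H₁⁰)ν*_{a₂}(H₂⁰)ν̄*_{a₁₂}((H₁ ∩̄ H₂)⁰)/φ([d, e])`
(`[d, e] = a₁a₂a₁₂`, `φ(a₁a₂a₁₂)`, `μ(d)μ(e) = μ(a₁)μ(a₂)μ(a₁₂)²`: the printed primed sum over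
pairwise coprime `(a₁, a₂, a₁₂)`; (9.15) rewrites it as a double contour integral).
[cite: GoldstonPintzYildirim2009, Section 9 eq. 9.12] -/
def mainTRTheta (R : ℝ) (H₁ H₂ : Finset ℕ) (ℓ₁ ℓ₂ h₀ : ℕ) : ℝ :=
  ((#H₁ + ℓ₁).factorial : ℝ)⁻¹ * ((#H₂ + ℓ₂).factorial : ℝ)⁻¹ *
    ∑ de ∈ Icc 1 ⌊R⌋₊ ×ˢ Icc 1 ⌊R⌋₊,
      (μ de.1 : ℝ) * (μ de.2 : ℝ) * Real.log (R / de.1) ^ (#H₁ + ℓ₁) *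
        Real.log (R / de.2) ^ (#H₂ + ℓ₂) *
        (nuJointStar h₀ H₁ H₂ de.1 de.2 / Nat.totient (Nat.lcm de.1 de.2) : ℝ)

/-- The `E'`-part of the error in (9.12): `𝓔 := ∑_{d, e ≤ R}♭ nuJoint(d, e) E'(N, [d, e])`
(squarefree pairs only; the printed `∑' d_k(a₁a₂a₁₂) E'(N, a₁a₂a₁₂)` up to `nuJoint ≤ d_k`). It is
estimated in `GoldstonPintzYildirimThetaBV` ((9.13)). [cite: GoldstonPintzYildirim2009, Section 9 eq. 9.12] -/
def thetaErrSum (R : ℝ) (H₁ H₂ : Finset ℕ) (N : ℕ) : ℝ :=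
  ∑ de ∈ Icc 1 ⌊R⌋₊ ×ˢ Icc 1 ⌊R⌋₊,
    if Squarefree de.1 ∧ Squarefree de.2 then
      (nuJoint H₁ H₂ de.1 de.2 : ℝ) * thetaErr N (Nat.lcm de.1 de.2) else 0

/-- `𝓔 ≥ 0`. [folklore] -/
theorem thetaErrSum_nonneg (R : ℝ) (H₁ H₂ : Finset ℕ) (N : ℕ) : 0 ≤ thetaErrSum R H₁ H₂ N :=
  Finset.sum_nonneg fun de _ => by
    split_ifs
    · exact mul_nonneg (Nat.cast_nonneg _) (thetaErr_nonneg _ _)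
    · exact le_rfl

/-- `log [d, e] ≤ 2 log R` for `1 ≤ d, e ≤ R`. [folklore] -/
theorem log_lcm_le {R : ℝ} {d e : ℕ} (hd1 : 1 ≤ d) (he1 : 1 ≤ e) (hdR : (d : ℝ) ≤ R)
    (heR : (e : ℝ) ≤ R) : Real.log (Nat.lcm d e) ≤ 2 * Real.log R := by
  have hd0 : (0 : ℝ) < d := by exact_mod_cast hd1
  have he0 : (0 : ℝ) < e := by exact_mod_cast he1
  have hl0 : (0 : ℝ) < Nat.lcm d e := by
    exact_mod_cast Nat.pos_of_ne_zero (Nat.lcm_ne_zero (by omega) (by omega))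
  have hle : (Nat.lcm d e : ℝ) ≤ d * e := by
    exact_mod_cast Nat.le_of_dvd (Nat.mul_pos hd1 he1) (Nat.lcm_dvd_mul d e)
  calc Real.log (Nat.lcm d e) ≤ Real.log (d * e) := Real.log_le_log hl0 hle
    _ = Real.log d + Real.log e := Real.log_mul hd0.ne' he0.ne'
    _ ≤ Real.log R + Real.log R :=
        add_le_add (Real.log_le_log hd0 hdR) (Real.log_le_log he0 heR)
    _ = 2 * Real.log R := by ring

/-- **GPY (9.12)**, first line, with explicit constants: for `R ≥ 1` and `k = k₁ + k₂ ≥ 1`,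
`|S̃_R(N; H₁,H₂,ℓ₁,ℓ₂,h₀) − N 𝒯̃_R(H₁,H₂,ℓ₁,ℓ₂,h₀)|`
`≤ ((log R)^{K₁+K₂}/(K₁!K₂!)) · (𝓔 + (2 log R + h₀ log(N + h₀)) (∑♭_{q ≤ R} d_k(q))²)`,
`Kᵢ = kᵢ + ℓᵢ`, from (9.7), (9.11), `nuJoint ≤ d_k(d)d_k(e)` and `log [d,e] ≤ 2 log R`; the printed
`O((log R)^M ∑' d_k(a₁a₂a₁₂)E'(N, a₁a₂a₁₂)) + O(hR²(3 log N)^{M+3k+1})` after Lemma 2.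
[cite: GoldstonPintzYildirim2009, Section 9 eq. 9.12] -/
theorem abs_sumTheta_sub_mainTRTheta_le {R : ℝ} (hR : 1 ≤ R) (H₁ H₂ : Finset ℕ)
    (hk : 1 ≤ #H₁ + #H₂) (ℓ₁ ℓ₂ N h₀ : ℕ) :
    |∑ n ∈ Icc 1 N, lambdaR R H₁ ℓ₁ n * lambdaR R H₂ ℓ₂ n * theta (n + h₀) -
        N * mainTRTheta R H₁ H₂ ℓ₁ ℓ₂ h₀| ≤
      ((#H₁ + ℓ₁).factorial : ℝ)⁻¹ * ((#H₂ + ℓ₂).factorial : ℝ)⁻¹ *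
        Real.log R ^ (#H₁ + ℓ₁ + (#H₂ + ℓ₂)) *
        (thetaErrSum R H₁ H₂ N +
          (2 * Real.log R + h₀ * Real.log ((N + h₀ : ℕ) : ℝ)) * sumDGen R (#H₁ + #H₂) ^ 2) := by
  rw [sum_lambdaR_mul_theta_eq, mainTRTheta, mul_left_comm (N : ℝ), ← mul_sub, Finset.mul_sum,
    ← Finset.sum_sub_distrib, abs_mul, abs_of_nonneg (by positivity)]
  conv_rhs => rw [mul_assoc]
  apply mul_le_mul_of_nonneg_left _ (by positivity)
  have hlogR : 0 ≤ Real.log R := Real.log_nonneg hR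
  have hlogNh : 0 ≤ Real.log ((N + h₀ : ℕ) : ℝ) := Real.log_natCast_nonneg _
  set A := 2 * Real.log R + h₀ * Real.log ((N + h₀ : ℕ) : ℝ) with hA
  have hA0 : 0 ≤ A := by positivity
  -- termwise bound
  have hterm : ∀ de ∈ Icc 1 ⌊R⌋₊ ×ˢ Icc 1 ⌊R⌋₊,
      |(μ de.1 : ℝ) * (μ de.2 : ℝ) * Real.log (R / de.1) ^ (#H₁ + ℓ₁) *
          Real.log (R / de.2) ^ (#H₂ + ℓ₂) *
          (∑ n ∈ (Icc 1 N).filter (fun n => de.1 ∣ tuplePoly H₁ n ∧ de.2 ∣ tuplePoly H₂ n),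
            theta (n + h₀)) -
        N * ((μ de.1 : ℝ) * (μ de.2 : ℝ) * Real.log (R / de.1) ^ (#H₁ + ℓ₁) *
          Real.log (R / de.2) ^ (#H₂ + ℓ₂) *
          (nuJointStar h₀ H₁ H₂ de.1 de.2 / Nat.totient (Nat.lcm de.1 de.2) : ℝ))| ≤
      Real.log R ^ (#H₁ + ℓ₁ + (#H₂ + ℓ₂)) *
        ((if Squarefree de.1 ∧ Squarefree de.2 then
            (nuJoint H₁ H₂ de.1 de.2 : ℝ) * thetaErr N (Nat.lcm de.1 de.2) else 0) +
          A * ((if Squarefree de.1 then dGen ((#H₁ : ℝ) + #H₂) de.1 else 0) *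
            (if Squarefree de.2 then dGen ((#H₁ : ℝ) + #H₂) de.2 else 0))) := by
    rintro ⟨d, e⟩ hde
    obtain ⟨hd, he⟩ := Finset.mem_product.1 hde
    obtain ⟨hd1, hdR⟩ := Finset.mem_Icc.1 hd
    obtain ⟨he1, heR⟩ := Finset.mem_Icc.1 he
    dsimp only
    by_cases hsd : Squarefree d
    · by_cases hse : Squarefree e
      · rw [if_pos ⟨hsd, hse⟩, if_pos hsd, if_pos hse]
        have hd0 : (0 : ℝ) < d := by exact_mod_cast hd1
        have he0 : (0 : ℝ) < e := by exact_mod_cast he1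
        have hRR : (⌊R⌋₊ : ℝ) ≤ R := Nat.floor_le (by linarith)
        have hdR' : (d : ℝ) ≤ R := le_trans (by exact_mod_cast hdR) hRR
        have heR' : (e : ℝ) ≤ R := le_trans (by exact_mod_cast heR) hRR
        have hfac : (μ d : ℝ) * (μ e : ℝ) * Real.log (R / d) ^ (#H₁ + ℓ₁) *
            Real.log (R / e) ^ (#H₂ + ℓ₂) *
            (∑ n ∈ (Icc 1 N).filter (fun n => d ∣ tuplePoly H₁ n ∧ e ∣ tuplePoly H₂ n),
              theta (n + h₀)) -
            N * ((μ d : ℝ) * (μ e : ℝ) * Real.log (R / d) ^ (#H₁ + ℓ₁) *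
              Real.log (R / e) ^ (#H₂ + ℓ₂) *
              (nuJointStar h₀ H₁ H₂ d e / Nat.totient (Nat.lcm d e) : ℝ)) =
            ((μ d : ℝ) * (μ e : ℝ)) * (Real.log (R / d) ^ (#H₁ + ℓ₁) *
              Real.log (R / e) ^ (#H₂ + ℓ₂)) *
              ((∑ n ∈ (Icc 1 N).filter (fun n => d ∣ tuplePoly H₁ n ∧ e ∣ tuplePoly H₂ n),
                theta (n + h₀)) -
                nuJointStar h₀ H₁ H₂ d e * ((N : ℝ) / Nat.totient (Nat.lcm d e))) := by ring
        rw [hfac, abs_mul, abs_mul]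
        have hμ : |(μ d : ℝ) * (μ e : ℝ)| ≤ 1 := by
          rw [abs_mul]
          have h1 : |(μ d : ℝ)| ≤ 1 := by
            rw [← Int.cast_abs]; exact_mod_cast ArithmeticFunction.abs_moebius_le_one
          have h2 : |(μ e : ℝ)| ≤ 1 := by
            rw [← Int.cast_abs]; exact_mod_cast ArithmeticFunction.abs_moebius_le_one
          exact mul_le_one₀ h1 (abs_nonneg _) h2
        have hl1 : 0 ≤ Real.log (R / d) := Real.log_nonneg ((one_le_div hd0).2 hdR')
        have hl2 : 0 ≤ Real.log (R / e) := Real.log_nonneg ((one_le_div he0).2 heR')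
        have hl1' : Real.log (R / d) ≤ Real.log R := by
          rw [Real.log_div (by linarith) hd0.ne']
          linarith [Real.log_nonneg (show (1 : ℝ) ≤ d by exact_mod_cast hd1)]
        have hl2' : Real.log (R / e) ≤ Real.log R := by
          rw [Real.log_div (by linarith) he0.ne']
          linarith [Real.log_nonneg (show (1 : ℝ) ≤ e by exact_mod_cast he1)]
        have hpow : |Real.log (R / d) ^ (#H₁ + ℓ₁) * Real.log (R / e) ^ (#H₂ + ℓ₂)| ≤
            Real.log R ^ (#H₁ + ℓ₁ + (#H₂ + ℓ₂)) := by
          rw [abs_of_nonneg (by positivity),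
            show Real.log R ^ (#H₁ + ℓ₁ + (#H₂ + ℓ₂)) =
              Real.log R ^ (#H₁ + ℓ₁) * Real.log R ^ (#H₂ + ℓ₂) from pow_add _ _ _]
          exact mul_le_mul (pow_le_pow_left₀ hl1 hl1' _) (pow_le_pow_left₀ hl2 hl2' _)
            (by positivity) (by positivity)
        have hinner := abs_sum_theta_filter_sub_le hsd hse H₁ H₂ N h₀
        have hν := nuJoint_le H₁ H₂ hk hsd.ne_zero hse.ne_zero
        have hν0 : (0 : ℝ) ≤ nuJoint H₁ H₂ d e := Nat.cast_nonneg _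
        have hE0 := thetaErr_nonneg N (Nat.lcm d e)
        have hlcm := log_lcm_le hd1 he1 hdR' heR'
        have hlcm0 : 0 ≤ Real.log (Nat.lcm d e) := Real.log_natCast_nonneg _
        calc |(μ d : ℝ) * (μ e : ℝ)| *
              |Real.log (R / d) ^ (#H₁ + ℓ₁) * Real.log (R / e) ^ (#H₂ + ℓ₂)| *
              |(∑ n ∈ (Icc 1 N).filter (fun n => d ∣ tuplePoly H₁ n ∧ e ∣ tuplePoly H₂ n),
                theta (n + h₀)) -
                nuJointStar h₀ H₁ H₂ d e * ((N : ℝ) / Nat.totient (Nat.lcm d e))|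
            ≤ 1 * Real.log R ^ (#H₁ + ℓ₁ + (#H₂ + ℓ₂)) *
                (nuJoint H₁ H₂ d e * (thetaErr N (Nat.lcm d e) + Real.log (Nat.lcm d e) +
                  h₀ * Real.log ((N + h₀ : ℕ) : ℝ))) := by
              apply mul_le_mul (mul_le_mul hμ hpow (abs_nonneg _) zero_le_one) hinner
                (abs_nonneg _) (by positivity)
          _ ≤ Real.log R ^ (#H₁ + ℓ₁ + (#H₂ + ℓ₂)) *
                ((nuJoint H₁ H₂ d e : ℝ) * thetaErr N (Nat.lcm d e) +
                  A * (dGen ((#H₁ : ℝ) + #H₂) d * dGen ((#H₁ : ℝ) + #H₂) e)) := by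
              rw [one_mul]
              refine mul_le_mul_of_nonneg_left ?_ (by positivity)
              have hν' : (nuJoint H₁ H₂ d e : ℝ) ≤
                  dGen ((#H₁ : ℝ) + #H₂) d * dGen ((#H₁ : ℝ) + #H₂) e := by
                exact_mod_cast hν
              have h2 : (nuJoint H₁ H₂ d e : ℝ) * (Real.log (Nat.lcm d e) +
                  h₀ * Real.log ((N + h₀ : ℕ) : ℝ)) ≤
                  (dGen ((#H₁ : ℝ) + #H₂) d * dGen ((#H₁ : ℝ) + #H₂) e) * A :=
                mul_le_mul hν' (by rw [hA]; linarith) (by positivity)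
                  (le_trans hν0 hν')
              nlinarith
      · have hμ0 : (μ e : ℝ) = 0 := by
          exact_mod_cast ArithmeticFunction.moebius_eq_zero_of_not_squarefree hse
        rw [hμ0, if_neg (fun h => hse h.2), if_neg hse]
        simp
    · have hμ0 : (μ d : ℝ) = 0 := by
        exact_mod_cast ArithmeticFunction.moebius_eq_zero_of_not_squarefree hsd
      rw [hμ0, if_neg (fun h => hsd h.1), if_neg hsd]
      simp
  calc |∑ de ∈ Icc 1 ⌊R⌋₊ ×ˢ Icc 1 ⌊R⌋₊, _| ≤ ∑ de ∈ Icc 1 ⌊R⌋₊ ×ˢ Icc 1 ⌊R⌋₊, |_| :=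
        Finset.abs_sum_le_sum_abs _ _
    _ ≤ ∑ de ∈ Icc 1 ⌊R⌋₊ ×ˢ Icc 1 ⌊R⌋₊, Real.log R ^ (#H₁ + ℓ₁ + (#H₂ + ℓ₂)) *
          ((if Squarefree de.1 ∧ Squarefree de.2 then
              (nuJoint H₁ H₂ de.1 de.2 : ℝ) * thetaErr N (Nat.lcm de.1 de.2) else 0) +
            A * ((if Squarefree de.1 then dGen ((#H₁ : ℝ) + #H₂) de.1 else 0) *
              (if Squarefree de.2 then dGen ((#H₁ : ℝ) + #H₂) de.2 else 0))) :=
        Finset.sum_le_sum hterm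
    _ = Real.log R ^ (#H₁ + ℓ₁ + (#H₂ + ℓ₂)) *
          (thetaErrSum R H₁ H₂ N + A * sumDGen R (#H₁ + #H₂) ^ 2) := by
        rw [← Finset.mul_sum, Finset.sum_add_distrib, ← Finset.mul_sum]
        congr 2
        congr 1
        rw [sq, sumDGen, squarefreeLE, Finset.sum_filter, Finset.sum_mul_sum, Finset.sum_product]

end Literature.NumberTheory.Sieve.GPY
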